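import Summits.QuantumFields.QCD.Theorems.QuarksAsStableActionStableActionBridgeStubScalarKernelProps
import HarnessLib

/-!
# The scalarised QCD transfer kernel conserves the fermion mode number
(stub `stub_modeNumber_selection` of line `twisted_trace_transfer` for crux
`QuarksAsStableAction.StableActionBridge`, item stmt-QuantumFields-9737, §8 E3, sub-goal Q2a)

Step E3 of the line realises Lüscher's transfer matrix of lattice QCD as the `L²` integral operator on
`Y = SU(3)^{E₃} × Finset(modes)` with the scalar kernel

  `k((U,s),(U',s')) = (R(U) · B(U,U') · R(U'))_{s s'}`,

where `R(U)` is a continuous Hermitian square root of the fermionic transfer operator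
`T̂_F(U) = fermionSliceOp U mq` lying in the bicommutant of `T̂_F(U)`, and
`B(U,U')_{a c} = ∫ K_β(U, U'^g) Γ(G_g)_{a c} dg` is the Gauss-averaged Wilson gauge bond kernel.
The vacuum-parity lemma Q2 needs that `k` conserves the MODE NUMBER `#s`:
`k((U,s),(U',s')) = 0` whenever `#s ≠ #s'`.

Proof: let `D := diag(#s : ℂ)` be the mode-number operator.  Every second quantisation `Γ(X) = fockLift X`
has vanishing entries off the particle-number diagonal (`fockLift_apply_of_card_ne`), so it commutes with
`D` (`diagonal_mul_eq_mul_diagonal_iff`); hence so do `T̂_F(U) = det² · Γ(M_F(U))` and every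
`Γ(G_g) = fockGaugeAct g`.  Consequently `R(U)` commutes with `D` (bicommutant hypothesis) and `B(U,U')`
commutes with `D` (its `(a,c)` entry vanishes for `#a ≠ #c`, the integrand does); so `R B R'` commutes with
`D` (the abstract selection lemma `kernel_selection` of the sibling stub `stub_scalarKernel_props`, which is
general in the diagonal weight), and its `(s,s')` entry vanishes when `(#s : ℂ) ≠ #s'`, i.e. when `#s ≠ #s'`
(`Nat.cast` is injective into `ℂ`).  Pure theorem file (no definitions, no local notations).

References: M. Lüscher, Commun. Math. Phys. 54 (1977) 283 [Luscher1977, pp. 283–292]; J. Smit,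
*Introduction to Quantum Fields on a Lattice* [Smit2023, §4.6 (4.125)–(4.127), §6.5 (6.91)].
-/

noncomputable section

open MeasureTheory
open scoped InnerProductSpace ComplexConjugate Matrix BigOperators
open Literature.MathematicalPhysics.QuantumFieldTheory Literature.MathematicalPhysics.QuantumLattice
open Literature.Probability.LatticeModels (TorusSite)

namespace Summit.QuantumFields.QCD.Cruxes.StableActionBridge.TwistedTraceTransfer

namespace StubModeNumberSelection

open StubScalarKernelProps

/-- **The mode-number operator commutes with every `Γ(X)`**: `diag(#s) Γ(X) = Γ(X) diag(#s)`
(`Γ(X)` preserves the particle number). [folklore] -/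
theorem modeNumber_comm_fockLift {ι : Type*} [LinearOrder ι] [Fintype ι] (X : Matrix ι ι ℂ) :
    Matrix.diagonal (fun s : Finset ι => (s.card : ℂ)) * fockLift X =
      fockLift X * Matrix.diagonal (fun s : Finset ι => (s.card : ℂ)) :=
  (diagonal_mul_eq_mul_diagonal_iff _ _).2 fun _ _ h =>
    fockLift_apply_of_card_ne X fun hc => h (by rw [hc])

variable {Nf S : ℕ} [NeZero S]

/-- **The mode-number operator commutes with the fermionic transfer operator**
`T̂_F(U) = (det A)² · Γ(M_F(U))`. [cite: Luscher1977, pp. 283–292] -/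
theorem modeNumber_comm_fermionSliceOp (U : GaugeConfig 3 S (Matrix.specialUnitaryGroup (Fin 3) ℂ))
    (mq : Fin Nf → ℝ) :
    Matrix.diagonal (fun s : Finset (SliceFermiIdx Nf S) => (s.card : ℂ)) * fermionSliceOp U mq =
      fermionSliceOp U mq * Matrix.diagonal (fun s : Finset (SliceFermiIdx Nf S) => (s.card : ℂ)) := by
  rw [fermionSliceOp, Matrix.mul_smul, Matrix.smul_mul, modeNumber_comm_fockLift]

end StubModeNumberSelection

open StubScalarKernelProps StubModeNumberSelection

/-- **Sub-goal Q2a (stub `stub_modeNumber_selection` of line `twisted_trace_transfer`): the scalarised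
transfer kernel conserves the mode number** (`k((U,s),(U',s')) = 0` unless `#s = #s'`): `T̂_F = det² Γ(M_F)`
and `Γ(G_g)` preserve `#s` (`fockLift X s t = 0` unless `#t = #s`), so does the bond kernel `B`, and `R` lies
in the bicommutant of `T̂_F` (which commutes with `diag #s`); hence `R B R'` commutes with `diag #s`.  First
input of the vacuum-parity lemma Q2 (a simple top eigenvalue lives in ONE mode-number sector).
[cite: Luscher1977, pp. 283–292] -/
theorem stub_modeNumber_selection : ∀ (Nf S : ℕ) [NeZero S] (β : ℝ) (mq : Fin Nf → ℝ), (∀ f, -1 < mq f) →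
    ∀ R : GaugeConfig 3 S (Matrix.specialUnitaryGroup (Fin 3) ℂ) → Matrix (Finset (SliceFermiIdx Nf S)) (Finset (SliceFermiIdx Nf S)) ℂ,
    Continuous R → (∀ U, (R U)ᴴ = R U ∧ R U * R U = fermionSliceOp U mq ∧
        ∀ P : Matrix (Finset (SliceFermiIdx Nf S)) (Finset (SliceFermiIdx Nf S)) ℂ,
          P * fermionSliceOp U mq = fermionSliceOp U mq * P → P * R U = R U * P) →
    ∀ k : GaugeConfig 3 S (Matrix.specialUnitaryGroup (Fin 3) ℂ) × Finset (SliceFermiIdx Nf S) → GaugeConfig 3 S (Matrix.specialUnitaryGroup (Fin 3) ℂ) × Finset (SliceFermiIdx Nf S) → ℂ,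
    (∀ y y', k y y' = (R y.1 * (Matrix.of fun a c => ∫ g : TorusSite 3 S → (Matrix.specialUnitaryGroup (Fin 3) ℂ),
          (gaugeSliceKernel β y.1 (gaugeTransform g y'.1) : ℂ) * @fockGaugeAct Nf S _ g a c
            ∂(Measure.pi fun _ => haarProbability (Matrix.specialUnitaryGroup (Fin 3) ℂ))) * R y'.1) y.2 y'.2) →
    ∀ y y', y.2.card ≠ y'.2.card → k y y' = 0 := by
  intro Nf S _ β mq _hmq R _hRc hR k hk
  -- abstract the Gauss-averaged bond kernel `B(U,U')`
  obtain ⟨B, hB⟩ : ∃ B : GaugeConfig 3 S (Matrix.specialUnitaryGroup (Fin 3) ℂ) →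
      GaugeConfig 3 S (Matrix.specialUnitaryGroup (Fin 3) ℂ) →
        Matrix (Finset (SliceFermiIdx Nf S)) (Finset (SliceFermiIdx Nf S)) ℂ,
      ∀ U U', B U U' = Matrix.of fun a c => ∫ g : TorusSite 3 S → (Matrix.specialUnitaryGroup (Fin 3) ℂ),
          (gaugeSliceKernel β U (gaugeTransform g U') : ℂ) * @fockGaugeAct Nf S _ g a c
            ∂(Measure.pi fun _ => haarProbability (Matrix.specialUnitaryGroup (Fin 3) ℂ)) :=
    ⟨_, fun _ _ => rfl⟩
  have hk' : ∀ y y', k y y' = (R y.1 * B y.1 y'.1 * R y'.1) y.2 y'.2 := fun y y' => by rw [hk, hB]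
  -- the mode-number operator `D = diag(#s)` commutes with `B(U,U')` (entrywise under the integral) ...
  have hBw : ∀ U U', Matrix.diagonal (fun s : Finset (SliceFermiIdx Nf S) => (s.card : ℂ)) * B U U' =
      B U U' * Matrix.diagonal (fun s : Finset (SliceFermiIdx Nf S) => (s.card : ℂ)) := fun U U' => by
    refine (diagonal_mul_eq_mul_diagonal_iff _ _).2 fun a c hac => ?_
    have hne : a.card ≠ c.card := fun h => hac (by rw [h])
    rw [hB, Matrix.of_apply]
    simp only [fockGaugeAct_apply_of_card_ne _ hne, mul_zero, integral_zero]
  -- ... and with `R(U)` (bicommutant of `T̂_F(U)`)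
  have hRw : ∀ U, Matrix.diagonal (fun s : Finset (SliceFermiIdx Nf S) => (s.card : ℂ)) * R U =
      R U * Matrix.diagonal (fun s : Finset (SliceFermiIdx Nf S) => (s.card : ℂ)) := fun U =>
    (hR U).2.2 _ (modeNumber_comm_fermionSliceOp U mq)
  intro y y' h
  exact kernel_selection R B k hk' _ hRw hBw y y' fun h' => h (Nat.cast_injective h')

end Summit.QuantumFields.QCD.Cruxes.StableActionBridge.TwistedTraceTransfer

end
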